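import Literature.Geometry.Lorentzian.KerrIngoingCoordMetric
import Literature.Geometry.Lorentzian.KerrPhotonOrbitHamiltonian

/-!
# Route PhotonSphereChannels — the outermost photon wall of Kerr clears the ergoregion

Helper file `--supports stmt-FinalStateConjecture-17430` (crux `ChannelsResolveTameDevelopmentsR`, K2R-T2):
the FIRST LEMMA of the crux-ideate round-2 card `legitimate-flanks-photon-wall`
(`Cruxes/ChannelsResolveTameDevelopmentsR/Ideas/legitimate-flanks-photon-wall.md`, first lemma (a)
`stationary_timelike_beyond_photonOrbit`, ideator-4 folder sketch — not mounted in a lead's jail, so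
re-proved here), over the Literature vocabulary `Kerr.Ingoing.bilin` (Kerr metric in ingoing Kerr
coordinates `u = (t*, r, μ, φ)`) and `Kerr.photonOrbitRadius` (retrograde equatorial photon orbit,
`r₀ ∈ [3M, 4M]`):

* `PhotonWall.bilin_basisVector_zero` — `g(∂_{t*}, ∂_{t*}) = −1 + 2Mr/Σ`, `Σ = r² + a²μ²`;
* `PhotonWall.stationary_timelike_of_two_mul_lt` — `∂_{t*}` is timelike wherever `r > 2M` (the
  ergoregion `{Σ < 2Mr}` lies in `{r ≤ 2M}`, for every spin and every latitude);
* `PhotonWall.stationary_timelike_beyond_photonOrbit` — in particular beyond the outermost photon wall: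
  `g(∂_{t*}, ∂_{t*}) < 0` for `r > photonOrbitRadius M |a|` (`≥ 3M > 2M`): the ergoregion clearance of
  the card's outer flank (there the stationary Killing field is timelike, so Müller zum Hagen's
  analyticity regime applies), for ALL spins `a` — no sub-extremality is needed for the inequality.

Declared in `…Theorems.PhotonWall` (the Literature namespace is not written into from `Summits/`).
No definitions. [folklore]
-/

noncomputable section

-- instance search through the nested operator types `E4 →L[ℝ] E4 →L[ℝ] ℝ`
set_option maxSynthPendingDepth 3

namespace Summit.FinalStateConjecture.FinalStateConjecture.Theorems

-- every `Summit.FinalStateConjecture.FinalStateConjecture.…` name repeats the summit = sub-problem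
-- segment (D-0017 layout), as in every landed `…Theorems` file of this route
set_option linter.dupNamespace false

namespace PhotonWall

open Literature.Geometry.Lorentzian Literature.Geometry.Lorentzian.Kerr
open Literature.Geometry.Lorentzian.Kerr.Ingoing

/-- **`g(∂_{t*}, ∂_{t*}) = −1 + 2Mr/Σ`** in ingoing Kerr coordinates (`r = u 1`, `μ = u 2`,
`Σ = r² + a²μ²`; Visser arXiv:0706.0622 (E:K1)). [folklore] -/
theorem bilin_basisVector_zero (M a : ℝ) (u : E4) :
    Ingoing.bilin M a u (E4.basisVector 0) (E4.basisVector 0) = -1 + 2 * (M * u 1 / sigma a u) := by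
  rw [Ingoing.bilin_apply]
  simp [E4.basisVector, h00, Ingoing.scalarH]

/-- **`∂_{t*}` is timelike outside `r = 2M`**: for `M ≥ 0` and `r > 2M`, `g(∂_{t*}, ∂_{t*}) < 0` at
every latitude and for every spin (`Σ = r² + a²μ² ≥ r² > 2Mr ≥ 0`, so `2Mr/Σ < 1`). [folklore] -/
theorem stationary_timelike_of_two_mul_lt {M a : ℝ} (hM : 0 ≤ M) {u : E4} (hu : 2 * M < u 1) :
    Ingoing.bilin M a u (E4.basisVector 0) (E4.basisVector 0) < 0 := by
  rw [bilin_basisVector_zero]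
  have hr : 0 < u 1 := by linarith
  have hS : u 1 ^ 2 ≤ sigma a u := by
    unfold sigma
    nlinarith [sq_nonneg (a * u 2)]
  have hS0 : 0 < sigma a u := lt_of_lt_of_le (by positivity) hS
  have hlt : 2 * (M * u 1) < sigma a u := by nlinarith
  have key : 2 * (M * u 1) / sigma a u < 1 := (div_lt_one hS0).2 hlt
  rw [show 2 * (M * u 1 / sigma a u) = 2 * (M * u 1) / sigma a u by ring]
  linarith

/-- **Ergoregion clearance of the outer flank** — the first lemma
`stationary_timelike_beyond_photonOrbit` of the crux-ideate card `legitimate-flanks-photon-wall`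
(crux stmt-FinalStateConjecture-17430): for `M > 0` and `r > photonOrbitRadius M |a|` (the outermost,
retrograde photon orbit radius, `≥ 3M`), `g(∂_{t*}, ∂_{t*}) = −1 + 2Mr/Σ < 0`.  So on the whole outer
flank `{r > r_ph(M, |a|)}` of the Kerr model the stationary Killing field `∂_{t*}` is timelike — the
outermost photon wall sits outside the ergoregion for EVERY spin `a`. [folklore] -/
theorem stationary_timelike_beyond_photonOrbit :
    ∀ (M a : ℝ), 0 < M → ∀ u : E4, photonOrbitRadius M |a| < u 1 →
      Ingoing.bilin M a u (E4.basisVector 0) (E4.basisVector 0) < 0 := by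
  intro M a hM u hu
  have h3 : 3 * M ≤ photonOrbitRadius M |a| := (photonOrbitRadius_mem hM (abs_nonneg a)).1
  exact stationary_timelike_of_two_mul_lt hM.le (by linarith)

end PhotonWall

end Summit.FinalStateConjecture.FinalStateConjecture.Theorems

end
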